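import Summits.HodgeConjecture.HodgeConjecture.Theorems.SixfoldTableXCensusSexticOneScalarAllMembers
import Summits.HodgeConjecture.HodgeConjecture.Theorems.SixfoldTableXCensusSexticOneBalancedAllMembers
import HarnessLib

/-!
# TABLE X (dimension 6) — row 12 `g6.IV(3,1)` (`End⁰ = F` a SEXTIC CM field, `dim_F H¹ = 2`), ALL MEMBERS WITH A
# `Θ`-SCALAR PLACE AND A BALANCED PLACE, NOT OF WEIL TYPE: one kernel verdict for the row, dispatching the CM patterns
# `(2,1,1)` (unconditional) and `(2,2,1)` (under the displayed geometric `hnW`) — cell `pub-hodgeav-hg6`, req-37 (A) Q2b, eng-5 g7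

HONEST FRAMING. HC, `HC_AV` (stmt-1333), `HC_CM` (stmt-3052) and the rung H2 are NOT proved and do not occur here. The
census nodes X2 / X1 of `SixfoldTableXCover` are OURS (`@[conjecture]`), never asserted; here they are DISCHARGED on one
isogeny class per hypothesis set. KERNEL ONLY: two dispatching theorems over the two pattern modules
`SixfoldTableXCensusSexticOneScalarAllMembers` (pattern `(2,1,1)`, eng-5 g6: one `Θ`-scalar place, two balanced — `hnW` not
needed) and `SixfoldTableXCensusSexticOneBalancedAllMembers` (pattern `(2,2,1)`, eng-5 g6: two `Θ`-scalar places, one balanced,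
under `hnW`); no definition, no `sorry`, no named fact; nothing restated. The member data are: `B` simple, `dim B = 6`,
`dim_ℚ End⁰(B) = 6`, `φ ∈ End(B)` with colours `μ : Fin 3 → ℂ` (injective, none conjugate to another or itself) of pair
multiplicity `2`, ONE `Θ`-SCALAR PLACE `k₀` and ONE BALANCED PLACE `k₁` (the all-scalar pattern is CM type, outside
`End⁰(B) = F`; the all-balanced pattern `(1,1,1)` has `Hg ⊆ SU_F` and is the named residual of row 12 — both displayed as member
data, not proved here), and the geometric no-Weil-type datum `hnW` (the Weil-type `(2,2,1)` members are TABLE X row 13).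
* `census_row12_sextic_of_scalar_of_balanced` — domain membership ∧ X2-at-`A` ∧ X1-at-`A` at every `A ∼ B`.
* `hodgeConjectureFor_of_isIsogenous_row12_sextic_of_scalar_of_balanced` — L6's CONCLUSION `HodgeConjectureFor` on the
  whole isogeny class.
HC / HC_AV are NOT proved beyond these statements' own content; typed ≠ proved.
-/

set_option linter.dupNamespace false

noncomputable section

open scoped TensorProduct
open CategoryTheory
open Literature.AlgebraicGeometry Literature.AlgebraicGeometry.Motives
open Literature.AlgebraicGeometry.Motives.AbelianVariety (IsIsogenous IsSimple)
open Literature.AlgebraicGeometry.HodgeTheory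
open Literature.AlgebraicGeometry.Milne1999
open Literature.AlgebraicTopology.SingularHomology
open Literature.Barriers.HodgeConjecture
open Summit.HodgeConjecture.HodgeConjecture.Ring2.ClassTargets
open Summit.HodgeConjecture.HodgeConjecture.Ring2.Motiv (ProdCMCell)
open Summit.HodgeConjecture.HodgeConjecture.Ring2.Atlas (IsQuarticFieldTypeIVFourfold)
open Summit.HodgeConjecture.HodgeConjecture.TableX.SimpleRows

namespace Summit.HodgeConjecture.HodgeConjecture.TableX.TypeIVRows

/-- The third element of `Fin 3`. [folklore] -/
private theorem fin3_exists_third (k₀ k₁ : Fin 3) (h : k₀ ≠ k₁) : ∃ k₂ : Fin 3, k₂ ≠ k₀ ∧ k₂ ≠ k₁ ∧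
    ∀ k : Fin 3, k = k₀ ∨ k = k₁ ∨ k = k₂ := by
  fin_cases k₀ <;> fin_cases k₁ <;> first
    | exact absurd rfl h
    | exact ⟨0, by decide, by decide, by decide⟩
    | exact ⟨1, by decide, by decide, by decide⟩
    | exact ⟨2, by decide, by decide, by decide⟩

/-- **TABLE X ROW 12 `g6.IV(3,1)`, ALL MEMBERS WITH A `Θ`-SCALAR PLACE `k₀` AND A BALANCED PLACE `k₁`, NOT OF WEIL TYPE —
KERNEL VERDICT on the whole isogeny class** (dispatch on the third place: balanced ⟹ pattern `(2,1,1)`,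
`census_row12_sextic_oneScalarPlace`, unconditional; `Θ`-scalar ⟹ pattern `(2,2,1)`, `census_row12_sextic_oneBalancedPlace`,
under the displayed `hnW`). HC ∕ HC_AV NOT proved; X2 ∕ X1 stay `@[conjecture]` globally.
[cite: MoonenZarhin1999LowDim, §1 (1.8), §2 (2.3) and §5 (5.1)] [cite: Ribet1983, Thm. 0] [cite: vanGeemen1994HodgeAV, Lemma 3.7]
[cite: MumfordAV1970, §19 Cor. 2 of Thm. 1 (p. 174)] -/
theorem census_row12_sextic_of_scalar_of_balanced {A B : AbelianVariety ℂ} (hB : B.dim = 6) (hBs : B.IsSimple) (φ : B ⟶ B)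
    (hE6 : Module.finrank ℚ B.endAlgebra = 6) (μ : Fin 3 → ℂ) (hinj : Function.Injective μ)
    (hdist : ∀ k k', μ k' ≠ starRingEnd ℂ (μ k))
    (hmult : ∀ k, eigenMultiplicity B φ (μ k) + eigenMultiplicity B φ (starRingEnd ℂ (μ k)) = 2) (k₀ : Fin 3)
    (hk₀ : eigenMultiplicity B φ (μ k₀) = 0 ∨ eigenMultiplicity B φ (starRingEnd ℂ (μ k₀)) = 0) (k₁ : Fin 3)
    (hk₁ : eigenMultiplicity B φ (μ k₁) ≠ 0 ∧ eigenMultiplicity B φ (starRingEnd ℂ (μ k₁)) ≠ 0)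
    (hnW : ∀ (d : ℕ) (β : B ⟶ B), 0 < d → β ≫ β = -(d • 𝟙 B) →
      eigenMultiplicity B β (Complex.I * (Real.sqrt d : ℂ)) ≠ eigenMultiplicity B β (-(Complex.I * (Real.sqrt d : ℂ))))
    (hAB : IsIsogenous A B) :
    (A.dim = 6 ∧ ¬ (IsOfCMType A ∨ ProdCMCell IsQuarticFieldTypeIVFourfold (fun Z ↦ Z.dim = 2) A)) ∧
    (∀ c : complexBetti A.X (2 * 2), IsRationalClass c → IsOfHodgeType A.dim A.X (2 * 2) 2 2 c →
      c ∈ divisorClassesSpan A.X A.dim 2 ⊔ Submodule.span ℂ {w' : complexBetti A.X (2 * 2) |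
        ∃ (C : AbelianVariety ℂ) (g : A.X ⟶ C.X) (w : complexBetti C.X (2 * 2)), C.dim < A.dim ∧
          IsRationalClass w ∧ IsOfHodgeType C.dim C.X (2 * 2) 2 2 w ∧ w' = complexBetti.map g (2 * 2) w}) ∧
    (∀ c : complexBetti A.X (2 * 3), IsRationalClass c → IsOfHodgeType A.dim A.X (2 * 3) 3 3 c →
      c ∈ divisorClassesSpan A.X A.dim 3 ⊔ Submodule.span ℂ {w' : complexBetti A.X (2 * 3) |
          ∃ (a : complexBetti A.X (2 * 2)) (b : complexBetti A.X (2 * 1)),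
            IsRationalClass a ∧ IsOfHodgeType A.dim A.X (2 * 2) 2 2 a ∧ IsRationalClass b ∧
            IsOfHodgeType A.dim A.X (2 * 1) 1 1 b ∧ w' = cupProduct (two_mul_add_two_mul 2 1) a b} ⊔
        Submodule.span ℂ {w' : complexBetti A.X (2 * 3) |
          ∃ (C : AbelianVariety ℂ) (g : A.X ⟶ C.X) (w : complexBetti C.X (2 * 3)), C.dim < A.dim ∧
            IsRationalClass w ∧ IsOfHodgeType C.dim C.X (2 * 3) 3 3 w ∧ w' = complexBetti.map g (2 * 3) w} ⊔
        Submodule.span ℂ {w' : complexBetti A.X (2 * 3) |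
          ∃ (B' : AbelianVariety ℂ) (g : A.X ⟶ B'.X) (d : ℕ) (ψ : B' ⟶ B') (w : complexBetti B'.X (2 * 3)),
            B'.dim = 6 ∧ 0 < d ∧ ψ ≫ ψ = -(d • 𝟙 B') ∧ IsRationalClass w ∧
            IsOfHodgeType B'.dim B'.X (2 * 3) 3 3 w ∧ w ∈ weilClassesOf B' ψ 3 d ∧
            w' = complexBetti.map g (2 * 3) w}) := by
  have h01 : k₀ ≠ k₁ := by
    rintro rfl
    exact hk₀.elim (fun h => hk₁.1 h) (fun h => hk₁.2 h)
  obtain ⟨k₂, hk₂₀, hk₂₁, huniv⟩ := fin3_exists_third k₀ k₁ h01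
  by_cases h : eigenMultiplicity B φ (μ k₂) = 0 ∨ eigenMultiplicity B φ (starRingEnd ℂ (μ k₂)) = 0
  · -- pattern `(2,2,1)`: `k₁` balanced, `k₀`, `k₂` scalar
    exact census_row12_sextic_oneBalancedPlace hB hBs φ hE6 μ hinj hdist hmult k₁ hk₁
      (fun k hk => by
        rcases huniv k with rfl | rfl | rfl
        · exact hk₀
        · exact (hk rfl).elim
        · exact h) k₀ k₂ hk₂₀.symm h01 hk₂₁ hnW hAB
  · -- pattern `(2,1,1)`: `k₀` scalar, `k₁`, `k₂` balanced
    rw [not_or] at h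
    exact census_row12_sextic_oneScalarPlace hB hBs φ hE6 μ hinj hdist hmult k₀ hk₀
      (fun k hk => by
        rcases huniv k with rfl | rfl | rfl
        · exact (hk rfl).elim
        · exact hk₁
        · exact h) hAB

/-- **L6's CONCLUSION on the isogeny class: the Hodge conjecture holds for every complex abelian variety isogenous to a SIMPLE
sixfold `B` with `dim_ℚ End⁰(B) = 6`, `φ ∈ End(B)` of pair multiplicity `2` (so `End⁰(B)` is a sextic CM field with
`dim_F H¹ = 2`), a `Θ`-scalar place, a balanced place, and `B` not of Weil type relative to any `β ∈ End(B)` with `β ≫ β = −d`**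
— dispatching `hodgeConjectureFor_of_isIsogenous_cmField_oneScalarPlace` (third place balanced; `hnW` unused) and
`hodgeConjectureFor_of_isIsogenous_cmField_oneBalancedPlace` (third place `Θ`-scalar; `hnW` displayed). None of Markman₄ /
Markman₆ / R-W6 / X2 / X1 / `HC_CM` enters. HC ∕ HC_AV NOT proved beyond this statement's own content.
[cite: MoonenZarhin1999LowDim, §1 (1.7)–(1.8) and §2 (2.3)] [cite: Ribet1983, Thm. 0] [cite: vanGeemen1994HodgeAV, §2.4 and Lemma 3.7] -/
theorem hodgeConjectureFor_of_isIsogenous_row12_sextic_of_scalar_of_balanced {A B : AbelianVariety ℂ} (hB : B.dim = 6)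
    (hBs : B.IsSimple) (φ : B ⟶ B) (hE6 : Module.finrank ℚ B.endAlgebra = 6) (μ : Fin 3 → ℂ)
    (hinj : Function.Injective μ) (hdist : ∀ k k', μ k' ≠ starRingEnd ℂ (μ k))
    (hmult : ∀ k, eigenMultiplicity B φ (μ k) + eigenMultiplicity B φ (starRingEnd ℂ (μ k)) = 2) (k₀ : Fin 3)
    (hk₀ : eigenMultiplicity B φ (μ k₀) = 0 ∨ eigenMultiplicity B φ (starRingEnd ℂ (μ k₀)) = 0) (k₁ : Fin 3)
    (hk₁ : eigenMultiplicity B φ (μ k₁) ≠ 0 ∧ eigenMultiplicity B φ (starRingEnd ℂ (μ k₁)) ≠ 0)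
    (hnW : ∀ (d : ℕ) (β : B ⟶ B), 0 < d → β ≫ β = -(d • 𝟙 B) →
      eigenMultiplicity B β (Complex.I * (Real.sqrt d : ℂ)) ≠ eigenMultiplicity B β (-(Complex.I * (Real.sqrt d : ℂ))))
    (hAB : IsIsogenous A B) : HodgeConjectureFor A.dim A.X := by
  have hι : Fintype.card (Fin 3) ≤ 3 := by rw [Fintype.card_fin]
  have hE : Module.finrank ℚ B.endAlgebra = 2 * Fintype.card (Fin 3) := by rw [hE6, Fintype.card_fin]
  have hdim : B.dim = Fintype.card (Fin 3) * 2 := by rw [hB, Fintype.card_fin]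
  have h01 : k₀ ≠ k₁ := by
    rintro rfl
    exact hk₀.elim (fun h => hk₁.1 h) (fun h => hk₁.2 h)
  obtain ⟨k₂, hk₂₀, hk₂₁, huniv⟩ := fin3_exists_third k₀ k₁ h01
  by_cases h : eigenMultiplicity B φ (μ k₂) = 0 ∨ eigenMultiplicity B φ (starRingEnd ℂ (μ k₂)) = 0
  · exact hodgeConjectureFor_of_isIsogenous_cmField_oneBalancedPlace hι hBs φ hE μ hinj hdist hmult hdim k₁ hk₁
      (fun k hk => by
        rcases huniv k with rfl | rfl | rfl
        · exact hk₀
        · exact (hk rfl).elim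
        · exact h) k₀ k₂ hk₂₀.symm h01 hk₂₁ hnW hAB
  · rw [not_or] at h
    exact hodgeConjectureFor_of_isIsogenous_cmField_oneScalarPlace hι hBs φ hE μ hinj hdist hmult hdim k₀ hk₀
      (fun k hk => by
        rcases huniv k with rfl | rfl | rfl
        · exact (hk rfl).elim
        · exact hk₁
        · exact h) hAB

end Summit.HodgeConjecture.HodgeConjecture.TableX.TypeIVRows

end
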